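import Summits.ResolutionOfSingularities.ResolutionOfSingularities.Theorems.NearCutPort
import Summits.ResolutionOfSingularities.ResolutionOfSingularities.Theorems.Rescue.ToricGuard
import HarnessLib

/-!
# NearCutCompanion — decomp-res node «NearCut» (lens-3 g22, critic row 170), tree file 4/10 of the node

Content VERBATIM from the decomp-res lens-3 g22 node `HOME/decomp-res-lens-3/g22/NearCut.lean` (pin 52e91527; HOME =
run/shared/lean/pub/decomp-res); critic row 170
BOOKED 0·0; landing orders INBOX :715 / :727 — provenance, critic text and the lens header in full in the first file
of the node, `NearCutForms`.  Namespace
`…Theorems.NearCut`; `--supports stmt-ResolutionOfSingularities-31770`; linear import chain in the lens's order.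

## This file

§N4 THE COMPANION LAW (kernel, PROVED): §N4a — `K[y^q]` (`IsQPoly`, sections `QPoly`, `QPolyField`),
multiplicativity of the chart transform across levels, the boundary factor, the lowest layer, two-wall separation
(sections `ChartAlgebra`, `Layers`); §N4b — NEAR, LAYER, the structure invariant along a δ-balanced plateau and
**`companionLaw`** (sections `LowCoeff`, `Structure`, `CompanionWalk`).  Continued in the numbered continuation
files where the 400-line cap cuts.  (This first part carries: `IsQPoly`, `isQPoly_zero`, `IsQPoly.add`,
`IsQPoly.neg`, `IsQPoly.sub`, `IsQPoly.mul`, `isQPoly_C`, `isQPoly_one`, `IsQPoly.pow`, `isQPoly_X_pow`,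
`IsQPoly.sum`, `IsQPoly.prod`, `isQPoly_monomial`, `isQPoly_translate`, `isQPoly_chartTransform`,
`isQPoly_sub_deletePthPowers`, `coeff_eq_zero_of_clean`, `homogeneousComponent_eq_of_add_qPoly`,
`chartTransform_mul_of_le` (the landed `PointBlowup.chartTransform_zero_eq_aeval`, `Rescue.ToricGuard.translate_mul_comm`,
`HauserPerlega2024.translate_add` are cited by name, not restated),
`translate_X_pow_self`.)

[WRITER NOTE (decomp-res writer g10): file split only (tree files ≤ 400 lines); namespace blocks, sections, section
variables, `open` lines and every declaration
exactly as in the lens; the three deprecated `Finsupp.degree_add` occurrences read `map_add` (definitionally the same lemma).]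

(Sources: cossart2020 (Cossart–Jannsen–Saito LNM 2270: Thm 5.40 p. 85, Defs 5.38/5.39 pp. 84–85, Thm 5.28 p. 72, Thm
5.35 / Cor 5.37); HauserPerlega2024 (Prop. 3 p. 791); Hauser2010Kangaroo (arXiv:0811.4151); Moh1987;
CossartPiltant2008 §2; Giraud1975; Hironaka1964.)
-/

noncomputable section

open MvPolynomial Finset
open Literature.AlgebraicGeometry.Resolution
open Literature.AlgebraicGeometry.Resolution.Hauser2010
open Literature.AlgebraicGeometry.Resolution.PointBlowup
open Summit.ResolutionOfSingularities.ResolutionOfSingularities.Theses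
open Summit.ResolutionOfSingularities.ResolutionOfSingularities.Theorems.TightDefectClasses
open Summit.ResolutionOfSingularities.ResolutionOfSingularities.Theorems.TightDefectStrongWalks
open Summit.ResolutionOfSingularities.ResolutionOfSingularities.Theorems.ItineraryCutClasses
open Summit.ResolutionOfSingularities.ResolutionOfSingularities.Theorems.BoundaryLedger
open Summit.ResolutionOfSingularities.ResolutionOfSingularities.Theorems.ProximityCut
open Summit.ResolutionOfSingularities.ResolutionOfSingularities.Theorems.ConeCutAxisLaw
open Literature.AlgebraicGeometry.Resolution.WeightedBlowup
open Literature.Barriers.ResolutionOfSingularities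
open Summit.ResolutionOfSingularities.ResolutionOfSingularities.Theorems.FloorCut
open Summit.ResolutionOfSingularities.ResolutionOfSingularities.Theorems.ConeCut
open Summit.ResolutionOfSingularities.ResolutionOfSingularities.Theorems.ExitLaw (fin3_cases eq_of_le_of_degree_le)
open Summit.ResolutionOfSingularities.ResolutionOfSingularities.Theorems.ShadeCut
open Summit.ResolutionOfSingularities.ResolutionOfSingularities.Theorems.TightCut
open Summit.ResolutionOfSingularities.ResolutionOfSingularities.Theorems.HoleCut

namespace Summit.ResolutionOfSingularities.ResolutionOfSingularities.Theorems.NearCut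

open Literature.AlgebraicGeometry.Resolution.HauserPerlega2024 (chartTransform_add chartTransform_monomial
  chartTransform_ne_zero)

section QPoly

variable {σ : Type*} {K : Type*} [CommRing K]

/-! ## §N4 THE COMPANION LAW (kernel, PROVED): `F_t = y^{r_t}·U_t·G_n + C_t`, `U_t(0) ≠ 0`, `C_t ∈ K[y^{p^e}]`,
and `ord₀ G_n = s` along every δ-balanced plateau.

### §N4a Generic algebra: the subring `K[y^q]` (as a predicate on exponents), multiplicativity of the chart transform,
translation lemmas, the lowest layer of `y^r·U·G`, and the separation of `q`-th powers from two walls. -/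

/-- `P ∈ K[y^q]`: every monomial of `P` has all its exponents divisible by `q` (any commutative coefficient ring: used for
`K` and, in §N5, for the Taylor coefficient ring `K[y]`).  DEFINITION (support). -/
def IsQPoly (q : ℕ) (P : MvPolynomial σ K) : Prop :=
  ∀ d : σ →₀ ℕ, coeff d P ≠ 0 → ∀ i, q ∣ d i

/-- `isQPoly_zero`: Auxiliary step of this node's calculus, VERBATIM from the lens file (see the module docstring);
the statement is its type. [folklore] -/
theorem isQPoly_zero (q : ℕ) : IsQPoly q (0 : MvPolynomial σ K) := fun d hd => (hd (coeff_zero d)).elim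

/-- `IsQPoly.add`: Auxiliary step of this node's calculus, VERBATIM from the lens file (see the module docstring);
the statement is its type. [folklore] -/
theorem IsQPoly.add {q : ℕ} {P Q : MvPolynomial σ K} (hP : IsQPoly q P) (hQ : IsQPoly q Q) : IsQPoly q (P + Q) := by
  intro d hd i
  rw [coeff_add] at hd
  by_cases h : coeff d P = 0
  · rw [h, zero_add] at hd; exact hQ d hd i
  · exact hP d h i

/-- `IsQPoly.neg`: Auxiliary step of this node's calculus, VERBATIM from the lens file (see the module docstring);
the statement is its type. [folklore] -/
theorem IsQPoly.neg {q : ℕ} {P : MvPolynomial σ K} (hP : IsQPoly q P) : IsQPoly q (-P) := by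
  intro d hd i
  rw [coeff_neg, neg_ne_zero] at hd
  exact hP d hd i

/-- `IsQPoly.sub`: Auxiliary step of this node's calculus, VERBATIM from the lens file (see the module docstring);
the statement is its type. [folklore] -/
theorem IsQPoly.sub {q : ℕ} {P Q : MvPolynomial σ K} (hP : IsQPoly q P) (hQ : IsQPoly q Q) : IsQPoly q (P - Q) := by
  rw [sub_eq_add_neg]; exact hP.add hQ.neg

/-- `IsQPoly.mul`: Auxiliary step of this node's calculus, VERBATIM from the lens file (see the module docstring);
the statement is its type. [folklore] -/
theorem IsQPoly.mul [DecidableEq σ] {q : ℕ} {P Q : MvPolynomial σ K} (hP : IsQPoly q P) (hQ : IsQPoly q Q) :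
    IsQPoly q (P * Q) := by
  classical
  intro d hd i
  rw [coeff_mul] at hd
  obtain ⟨x, hx, hne⟩ := Finset.exists_ne_zero_of_sum_ne_zero hd
  have h1 : coeff x.1 P ≠ 0 := fun h => hne (by rw [h, zero_mul])
  have h2 : coeff x.2 Q ≠ 0 := fun h => hne (by rw [h, mul_zero])
  have hsum : x.1 + x.2 = d := Finset.HasAntidiagonal.mem_antidiagonal.mp hx
  rw [← hsum, Finsupp.add_apply]
  exact dvd_add (hP x.1 h1 i) (hQ x.2 h2 i)

/-- `isQPoly_C`: Auxiliary step of this node's calculus, VERBATIM from the lens file (see the module docstring); the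
statement is its type. [folklore] -/
theorem isQPoly_C (q : ℕ) (c : K) : IsQPoly q (C c : MvPolynomial σ K) := by
  classical
  intro d hd i
  rw [coeff_C] at hd
  split_ifs at hd with h
  · rw [← h]; exact dvd_zero q
  · exact (hd rfl).elim

/-- `isQPoly_one`: Auxiliary step of this node's calculus, VERBATIM from the lens file (see the module docstring);
the statement is its type. [folklore] -/
theorem isQPoly_one (q : ℕ) : IsQPoly q (1 : MvPolynomial σ K) := by
  rw [← C_1]; exact isQPoly_C q 1

/-- `IsQPoly.pow`: Auxiliary step of this node's calculus, VERBATIM from the lens file (see the module docstring);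
the statement is its type. [folklore] -/
theorem IsQPoly.pow [DecidableEq σ] {q : ℕ} {P : MvPolynomial σ K} (hP : IsQPoly q P) (n : ℕ) : IsQPoly q (P ^ n) := by
  induction n with
  | zero => rw [pow_zero]; exact isQPoly_one q
  | succ n ih => rw [pow_succ]; exact ih.mul hP

/-- `isQPoly_X_pow`: Auxiliary step of this node's calculus, VERBATIM from the lens file (see the module docstring);
the statement is its type. [folklore] -/
theorem isQPoly_X_pow [DecidableEq σ] (q : ℕ) (i : σ) : IsQPoly q (X i ^ q : MvPolynomial σ K) := by
  classical
  intro d hd l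
  rw [X_pow_eq_monomial, coeff_monomial] at hd
  split_ifs at hd with h
  · rw [← h, Finsupp.single_apply]
    split_ifs
    · exact dvd_rfl
    · exact dvd_zero q
  · exact (hd rfl).elim

/-- `IsQPoly.sum`: Auxiliary step of this node's calculus, VERBATIM from the lens file (see the module docstring);
the statement is its type. [folklore] -/
theorem IsQPoly.sum [DecidableEq σ] {ι : Type*} {q : ℕ} (s : Finset ι) {f : ι → MvPolynomial σ K}
    (h : ∀ a ∈ s, IsQPoly q (f a)) : IsQPoly q (∑ a ∈ s, f a) := by
  classical
  induction s using Finset.induction_on with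
  | empty => rw [Finset.sum_empty]; exact isQPoly_zero q
  | insert a s ha ih =>
    rw [Finset.sum_insert ha]
    exact (h a (Finset.mem_insert_self a s)).add (ih fun b hb => h b (Finset.mem_insert_of_mem hb))

/-- `IsQPoly.prod`: Auxiliary step of this node's calculus, VERBATIM from the lens file (see the module docstring);
the statement is its type. [folklore] -/
theorem IsQPoly.prod [DecidableEq σ] {ι : Type*} {q : ℕ} (s : Finset ι) {f : ι → MvPolynomial σ K}
    (h : ∀ a ∈ s, IsQPoly q (f a)) : IsQPoly q (∏ a ∈ s, f a) := by
  classical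
  induction s using Finset.induction_on with
  | empty => rw [Finset.prod_empty]; exact isQPoly_one q
  | insert a s ha ih =>
    rw [Finset.prod_insert ha]
    exact (h a (Finset.mem_insert_self a s)).mul (ih fun b hb => h b (Finset.mem_insert_of_mem hb))

/-- `isQPoly_monomial`: Auxiliary step of this node's calculus, VERBATIM from the lens file (see the module
docstring); the statement is its type. [folklore] -/
theorem isQPoly_monomial (q : ℕ) {d : σ →₀ ℕ} (hd : ∀ i, q ∣ d i) (c : K) : IsQPoly q (monomial d c) := by
  classical
  intro e he i
  rw [coeff_monomial] at he
  split_ifs at he with h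
  · rw [← h]; exact hd i
  · exact (he rfl).elim

end QPoly

section QPolyField

variable {σ : Type*} {K : Type*} [Field K]

/-- `K[y^q]` is stable under translations in characteristic `p`, `q = p^e`: `(y + b)^{qk} = (y^q + b^q)^k`.
[folklore] -/
theorem isQPoly_translate [Fintype σ] [DecidableEq σ] {p : ℕ} [hp : Fact p.Prime] [CharP K p] (e : ℕ) (b : σ → K)
    {P : MvPolynomial σ K} (hP : IsQPoly (p ^ e) P) : IsQPoly (p ^ e) (translate b P) := by
  classical
  have hsum : translate b P = ∑ d ∈ P.support, translate b (monomial d (coeff d P)) := by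
    conv_lhs => rw [P.as_sum]
    rw [translate_finset_sum]
  rw [hsum]
  refine IsQPoly.sum _ fun d hd => ?_
  rw [translate_monomial_eq_prod]
  refine (isQPoly_C _ _).mul (IsQPoly.prod _ fun i _ => ?_)
  obtain ⟨k, hk⟩ := hP d (MvPolynomial.mem_support_iff.mp hd) i
  rw [hk, pow_mul, add_pow_char_pow, ← map_pow]
  exact ((isQPoly_X_pow _ _).add (isQPoly_C _ _)).pow k

/-- `K[y^q]` is stable under the chart transform at level `q`. [folklore] -/
theorem isQPoly_chartTransform [Fintype σ] [DecidableEq σ] {q : ℕ} (j : σ) {P : MvPolynomial σ K}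
    (hP : IsQPoly q P) : IsQPoly q (chartTransform q j P) := by
  classical
  intro E hE i
  unfold PointBlowup.chartTransform at hE
  rw [coeff_sum] at hE
  obtain ⟨d, hd, hne⟩ := Finset.exists_ne_zero_of_sum_ne_zero hE
  rw [coeff_monomial] at hne
  split_ifs at hne with h
  · rw [← h, chartExponent_apply]
    have hdi := hP d (MvPolynomial.mem_support_iff.mp hd)
    split_ifs
    · have hdeg : q ∣ d.degree := by
        rw [Finsupp.degree_eq_sum]
        exact Finset.dvd_sum fun l _ => hdi l
      exact Nat.dvd_sub hdeg dvd_rfl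
    · exact hdi i
  · exact (hne rfl).elim

/-- The part removed by cleaning lies in `K[y^q]`. [folklore] -/
theorem isQPoly_sub_deletePthPowers [DecidableEq σ] (q : ℕ) (P : MvPolynomial σ K) :
    IsQPoly q (P - deletePthPowers q P) := by
  intro d hd i
  rw [coeff_sub, coeff_deletePthPowers] at hd
  split_ifs at hd with h
  · exact (isPthPowerExponent_iff q d).mp h i
  · rw [sub_self] at hd; exact (hd rfl).elim

/-- A cleaned polynomial has no monomial in `K[y^q]`. [folklore] -/
theorem coeff_eq_zero_of_clean [DecidableEq σ] {q : ℕ} {P : MvPolynomial σ K} (hP : deletePthPowers q P = P)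
    {d : σ →₀ ℕ} (hd : ∀ i, q ∣ d i) : coeff d P = 0 := by
  rw [← hP, coeff_deletePthPowers, if_pos ((isPthPowerExponent_iff q d).mpr hd)]

/-- **SEPARATION.**  If `F = A + C` with `C ∈ K[y^q]`, `F` cleaned, and `A` has no `K[y^q]`-monomial in degree `k`,
then `in_k(F) = in_k(A)`. [folklore] -/
theorem homogeneousComponent_eq_of_add_qPoly [DecidableEq σ] {q : ℕ} {F A C : MvPolynomial σ K}
    (hF : deletePthPowers q F = F) (hC : IsQPoly q C) (hFA : F = A + C) (k : ℕ)
    (hA : ∀ d : σ →₀ ℕ, d.degree = k → coeff d A ≠ 0 → ¬ ∀ i, q ∣ d i) :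
    homogeneousComponent k F = homogeneousComponent k A := by
  classical
  ext d
  rw [coeff_homogeneousComponent, coeff_homogeneousComponent]
  split_ifs with hdk
  · rw [hFA, coeff_add]
    by_cases hq : ∀ i, q ∣ d i
    · have h0 : coeff d F = 0 := coeff_eq_zero_of_clean hF hq
      rw [hFA, coeff_add] at h0
      have hA0 : coeff d A = 0 := by by_contra h; exact hA d hdk h hq
      rw [hA0, zero_add] at h0 ⊢
      exact h0
    · have hC0 : coeff d C = 0 := by by_contra h; exact hq (hC d h)
      rw [hC0, add_zero]
  · rfl

end QPolyField

section ChartAlgebra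

variable {σ : Type*} [Fintype σ] [DecidableEq σ] {K : Type*} [Field K]

omit [Fintype σ] in
/-- **MULTIPLICATIVITY OF THE CHART TRANSFORM** across levels: `cT_{a+b}(P·Q) = cT_a(P) · cT_b(Q)` when `a ≤ ord P`,
`b ≤ ord Q` (both sides are the total transform divided by `y_j^{a+b}`). [folklore] -/
theorem chartTransform_mul_of_le (j : σ) {a b : ℕ} {P Q : MvPolynomial σ K} (hP : (a : ℕ∞) ≤ ordZero P)
    (hQ : (b : ℕ∞) ≤ ordZero Q) :
    chartTransform (a + b) j (P * Q) = chartTransform a j P * chartTransform b j Q := by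
  have hPQ : ((a + b : ℕ) : ℕ∞) ≤ ordZero (P * Q) :=
    le_trans (by push_cast; exact add_le_add hP hQ) (le_ordZero_mul P Q)
  have h := X_pow_mul_chartTransform j hPQ
  rw [map_mul, ← X_pow_mul_chartTransform j hP, ← X_pow_mul_chartTransform j hQ,
    show X j ^ a * chartTransform a j P * (X j ^ b * chartTransform b j Q)
      = X j ^ (a + b) * (chartTransform a j P * chartTransform b j Q) by ring] at h
  exact mul_left_cancel₀ (pow_ne_zero _ (X_ne_zero j)) h

omit [Fintype σ] [DecidableEq σ] in
/-- `translate_X_pow_self`: Auxiliary step of this node's calculus, VERBATIM from the lens file (see the module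
docstring); the statement is its type. [folklore] -/
theorem translate_X_pow_self (b : σ → K) {j : σ} (hbj : b j = 0) (n : ℕ) :
    translate b (X j ^ n : MvPolynomial σ K) = X j ^ n := by
  rw [translate_eq_aeval, map_pow, aeval_X, hbj, C_0, add_zero]

end ChartAlgebra

end Summit.ResolutionOfSingularities.ResolutionOfSingularities.Theorems.NearCut
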